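import Summits.QuantumFields.YangMills.Theorems.AllWindowsColdBoxBoxHighLineSmearedFPOperator
import Summits.QuantumFields.YangMills.Theorems.AllWindowsColdBoxBoxHighLineSpectralFloorTools

/-!
# Laplace SANDWICH for the orbit average `N_h` — part (4k-H): the operator UPPER bound of the flat Faddeev–Popov operator,
# `‖fpOperator H 1 · v‖² ≤ 256·|v|²` (Schur test on the Dirichlet Laplacian: every row of `Δ_Λ` has ℓ¹-mass `≤ 4d = 16`), and the triangle
# inequality `opBound_add` that carries it to `fpOperator H V = fpOperator H 1 + E` (4c-E).  Input `M` of hypothesis (bulk-Φ) of 4k-G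
# (`|Φ − ‖FA‖²| ≤ 2M‖q‖|A| + ‖q‖² ≤ κ|A|²`); LINE-19 S5 ⟨stmt-QuantumFields-24004⟩/⟨24335⟩, LINE-20 U5 ⟨24336⟩; seat ym-line-fcl-p3 g25.

HONEST LABEL: an elementary brick of step (1b)/(1c); T-S5.4, S5, U5 and the three items are OPEN; the Yang–Mills mass gap is NOT proved by this file;
no summit is proved by a line.
-/

set_option autoImplicit false

noncomputable section

open Matrix Finset
open Literature.Probability.LatticeModels
open Literature.MathematicalPhysics.QuantumLattice

namespace Summit.QuantumFields.YangMills.Theorems.AllWindowsColdBoxBoxHighLine.LaplaceSandwich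

open scoped Kronecker

/-! ## §1 Row ℓ¹-mass of the Dirichlet Laplacian -/

/-- ★ **Every row of the Dirichlet Laplacian `Δ_Λ` of a finite `Λ ⊆ ℤ^d` has ℓ¹-mass at most `4d`** (`2d` on the diagonal, `−1` on at most `2d`
lattice neighbours). [folklore] -/
theorem sum_abs_dirichletMatrix_le {d : ℕ} (Λ : Finset (Site d)) (x : Λ) : ∑ y, |dirichletMatrix Λ x y| ≤ 4 * d := by
  classical
  have hsplit : ∑ y, |dirichletMatrix Λ x y| =
      |dirichletMatrix Λ x x| + ∑ y ∈ univ.erase x, |dirichletMatrix Λ x y| := by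
    rw [← Finset.add_sum_erase _ _ (mem_univ x)]
  have hdiag : |dirichletMatrix Λ x x| = 2 * d := by
    simp only [dirichletMatrix, if_true]
    rw [abs_of_nonneg (by positivity)]
  have hoff : ∀ y ∈ univ.erase x, |dirichletMatrix Λ x y| = if (zdGraph d).Adj (x : Site d) y then (1 : ℝ) else 0 := by
    intro y hy
    have hne : x ≠ y := (ne_of_mem_erase hy).symm
    simp only [dirichletMatrix, if_neg hne]
    split_ifs <;> simp
  rw [hsplit, hdiag, sum_congr rfl hoff]
  -- the off-diagonal count is the number of neighbours of `x` inside `Λ`, at most `2d`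
  have hcount : ∑ y ∈ univ.erase x, (if (zdGraph d).Adj (x : Site d) y then (1 : ℝ) else 0) ≤ 2 * d := by
    rw [← sum_filter, sum_const, nsmul_eq_mul, mul_one]
    have hinj : ((univ.erase x).filter fun y : Λ => (zdGraph d).Adj (x : Site d) y).card ≤ ((zdGraph d).neighborFinset (x : Site d)).card := by
      refine Finset.card_le_card_of_injOn (fun y : Λ => (y : Site d)) (fun y hy => ?_) (fun y _ z _ h => Subtype.ext h)
      rw [Finset.mem_coe, Finset.mem_filter] at hy
      rw [Finset.mem_coe, SimpleGraph.mem_neighborFinset]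
      exact hy.2
    rw [card_neighborFinset_zdGraph_holds] at hinj
    exact_mod_cast hinj
  linarith

/-- Columns too (the matrix is symmetric). [folklore] -/
theorem sum_abs_dirichletMatrix_col_le {d : ℕ} (Λ : Finset (Site d)) (y : Λ) : ∑ x, |dirichletMatrix Λ x y| ≤ 4 * d := by
  have h := sum_abs_dirichletMatrix_le Λ y
  refine le_of_eq_of_le (Finset.sum_congr rfl fun x _ => ?_) h
  rw [← dirichletMatrix_transpose Λ, Matrix.transpose_apply, dirichletMatrix_transpose]

/-! ## §2 The operator bound of `Δ_Λ ⊗ 1` and of `fpOperator H 1` -/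

/-- Rows of `Δ_Λ ⊗ₖ 1ₒ` have the same ℓ¹-mass as rows of `Δ_Λ`. [folklore] -/
theorem sum_abs_kronecker_one_row {d : ℕ} (Λ : Finset (Site d)) {o : Type} [Fintype o] [DecidableEq o] (p : Λ × o) :
    ∑ q, |(dirichletMatrix Λ ⊗ₖ (1 : Matrix o o ℝ)) p q| = ∑ y, |dirichletMatrix Λ p.1 y| := by
  rw [← Finset.univ_product_univ, Finset.sum_product]
  refine Finset.sum_congr rfl fun y _ => ?_
  simp only [Matrix.kroneckerMap_apply, Matrix.one_apply, mul_ite, mul_one, mul_zero]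
  simp [apply_ite abs, Finset.sum_ite_eq]

/-- Columns likewise. [folklore] -/
theorem sum_abs_kronecker_one_col {d : ℕ} (Λ : Finset (Site d)) {o : Type} [Fintype o] [DecidableEq o] (q : Λ × o) :
    ∑ p, |(dirichletMatrix Λ ⊗ₖ (1 : Matrix o o ℝ)) p q| = ∑ x, |dirichletMatrix Λ x q.1| := by
  rw [← Finset.univ_product_univ, Finset.sum_product]
  refine Finset.sum_congr rfl fun x _ => ?_
  simp only [Matrix.kroneckerMap_apply, Matrix.one_apply, mul_ite, mul_one, mul_zero]
  simp [apply_ite abs, Finset.sum_ite_eq']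

/-- ★ **Operator bound of `Δ_Λ ⊗ₖ 1ₒ`**: `‖(Δ_Λ ⊗ 1) w‖² ≤ (4d)²·|w|²` (Schur test, w4's ✓`mulVec_dotProduct_self_le_of_row_col`). [folklore] -/
theorem kronecker_one_opBound {d : ℕ} (Λ : Finset (Site d)) {o : Type} [Fintype o] [DecidableEq o] (w : Λ × o → ℝ) :
    ((dirichletMatrix Λ ⊗ₖ (1 : Matrix o o ℝ)) *ᵥ w) ⬝ᵥ ((dirichletMatrix Λ ⊗ₖ (1 : Matrix o o ℝ)) *ᵥ w) ≤ (4 * d) ^ 2 * (w ⬝ᵥ w) :=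
  SpectralFloor.mulVec_dotProduct_self_le_of_row_col _ (by positivity)
    (fun p => by rw [sum_abs_kronecker_one_row]; exact sum_abs_dirichletMatrix_le Λ p.1)
    (fun q => by rw [sum_abs_kronecker_one_col]; exact sum_abs_dirichletMatrix_col_le Λ q.1) w

/-- ★★ **Operator UPPER bound of the flat Faddeev–Popov operator**: `‖fpOperator H 1 · v‖² ≤ 256·|v|²` (`d = 4`: `(4d)² = 256`). [folklore] -/
theorem fpOperator_one_opBound (H : ℕ) (v : ↥(interiorSites H) × Fin 3 → ℝ) :
    (fpOperator H 1 *ᵥ v) ⬝ᵥ (fpOperator H 1 *ᵥ v) ≤ 256 * (v ⬝ᵥ v) := by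
  rw [fpOperator_one_normSq_eq]
  have h := kronecker_one_opBound (interiorSites H) (o := Fin 3) v
  norm_num at h
  exact h

/-! ## §3 Triangle inequality for operator bounds -/

/-- ★ **`opBound_add`**: `‖Av‖² ≤ a²|v|²`, `‖Ev‖² ≤ m²|v|²` (`a, m ≥ 0`) ⇒ `‖(A + E)v‖² ≤ (a + m)²|v|²`. [folklore] -/
theorem opBound_add {ι : Type*} [Fintype ι] (A E : Matrix ι ι ℝ) {a m : ℝ} (ha : 0 ≤ a) (hm : 0 ≤ m)
    (hA : ∀ v : ι → ℝ, (A *ᵥ v) ⬝ᵥ (A *ᵥ v) ≤ a ^ 2 * (v ⬝ᵥ v))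
    (hE : ∀ v : ι → ℝ, (E *ᵥ v) ⬝ᵥ (E *ᵥ v) ≤ m ^ 2 * (v ⬝ᵥ v)) (v : ι → ℝ) :
    ((A + E) *ᵥ v) ⬝ᵥ ((A + E) *ᵥ v) ≤ (a + m) ^ 2 * (v ⬝ᵥ v) := by
  have hv0 : 0 ≤ v ⬝ᵥ v := Finset.sum_nonneg fun i _ => mul_self_nonneg _
  have hA0 : 0 ≤ (A *ᵥ v) ⬝ᵥ (A *ᵥ v) := Finset.sum_nonneg fun i _ => mul_self_nonneg _
  have hE0 : 0 ≤ (E *ᵥ v) ⬝ᵥ (E *ᵥ v) := Finset.sum_nonneg fun i _ => mul_self_nonneg _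
  have hcs : ((A *ᵥ v) ⬝ᵥ (E *ᵥ v)) ^ 2 ≤ ((A *ᵥ v) ⬝ᵥ (A *ᵥ v)) * ((E *ᵥ v) ⬝ᵥ (E *ᵥ v)) := by
    simpa only [dotProduct, sq] using Finset.sum_mul_sq_le_sq_mul_sq Finset.univ (A *ᵥ v) (E *ᵥ v)
  -- `(AE) ≤ a m |v|²`
  have hcross : (A *ᵥ v) ⬝ᵥ (E *ᵥ v) ≤ a * m * (v ⬝ᵥ v) := by
    have h1 : ((A *ᵥ v) ⬝ᵥ (E *ᵥ v)) ^ 2 ≤ (a * m * (v ⬝ᵥ v)) ^ 2 := by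
      calc ((A *ᵥ v) ⬝ᵥ (E *ᵥ v)) ^ 2 ≤ ((A *ᵥ v) ⬝ᵥ (A *ᵥ v)) * ((E *ᵥ v) ⬝ᵥ (E *ᵥ v)) := hcs
        _ ≤ (a ^ 2 * (v ⬝ᵥ v)) * (m ^ 2 * (v ⬝ᵥ v)) := mul_le_mul (hA v) (hE v) hE0 (by positivity)
        _ = (a * m * (v ⬝ᵥ v)) ^ 2 := by ring
    exact (abs_le_of_sq_le_sq' h1 (by positivity)).2
  rw [Matrix.add_mulVec, add_dotProduct, dotProduct_add, dotProduct_add, dotProduct_comm (E *ᵥ v) (A *ᵥ v)]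
  nlinarith [hA v, hE v, hcross, mul_nonneg ha hm]

end Summit.QuantumFields.YangMills.Theorems.AllWindowsColdBoxBoxHighLine.LaplaceSandwich

end
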